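/-
Copyright: H21 programme, solo seat `solo-RiemannHypothesis-informed` (session 4).
-/
import Summits.RiemannHypothesis.RiemannHypothesis.Theorems.SoloInformedEffMain
import Mathlib.MeasureTheory.Group.Integral
import Mathlib.Analysis.SpecialFunctions.Trigonometric.DerivHyp
import Literature.Topology.FourManifolds.RailNeck

/-!
# The window bump `ψ₁` has mass one and `Φ₁ ≥ 1` (solo-informed, T24)

For the fixed bump `ψ₁ = windowPlateau 1` (`ψ₁(s) = ST(1−s)·ST(1+s)`, `ST = Real.smoothTransition`):
* `ST x + ST (1 − x) = 1` (tree: `smoothTransition_add_smoothTransition_one_sub`), hence `ψ₁(s − 1) + ψ₁(s) = 1` on `[0,1]` and `∫ ψ₁ = 1`;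
* `ψ₁` is even, so `Φ₁(−θ) = Φ₁(θ)` (`Φ₁ = bumpLaplace ψ₁`) and `Φ₁(θ) = ∫ ψ₁ cosh(θ·) ≥ ∫ ψ₁ = 1`;
* consequently the double-log offset of T17/T18/T20 satisfies
  `doubleLogC0 ψ₁ η ≤ max (log 3 / η) (log (4·bumpK ψ₁/η⁴ + 1) / (2η))` (`η > 0`),
  and under the named fact `zetaZeroCount_hasanalizade_shen_wong`
  `bumpK ψ₁ ≤ 108000·N₁ + 1`, `N₁ = ‖ψ₁″‖₁² + ‖ψ₁‴‖₁² + 2‖ψ₁⁗‖₁²` — the single un-evaluated number.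
The last theorem assembles the fully explicit exclusion statement.
-/

open MeasureTheory Complex Set Filter Topology Literature.NumberTheory.LFunctions
open scoped ContDiff

namespace Summit.RiemannHypothesis.RiemannHypothesis.Theorems

/-- Partition of unity: `ψ₁(s − 1) + ψ₁(s) = 1` for `s ∈ [0, 1]`. -/
theorem windowPlateau_one_partition {s : ℝ} (hs : s ∈ Icc (0 : ℝ) 1) :
    windowPlateau 1 (s - 1) + windowPlateau 1 s = 1 := by
  unfold windowPlateau
  have h1 : Real.smoothTransition (1 - (s - 1)) = 1 :=
    Real.smoothTransition.one_of_one_le (by linarith [hs.2])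
  have h2 : Real.smoothTransition (1 + s) = 1 :=
    Real.smoothTransition.one_of_one_le (by linarith [hs.1])
  rw [h1, h2, one_mul, mul_one, show (1 : ℝ) + (s - 1) = s by ring]
  exact Literature.Topology.FourManifolds.smoothTransition_add_smoothTransition_one_sub s

/-- **Mass one:** `∫ ψ₁ = 1`. -/
theorem integral_windowPlateau_one : ∫ s, windowPlateau 1 s = 1 := by
  have hc := continuous_windowPlateau 1
  have hsupp : Function.support (windowPlateau 1) ⊆ Ioc (-1 : ℝ) 1 := by
    intro s hs
    have h1 : s ∈ Icc (-1 : ℝ) 1 := tsupport_windowPlateau_subset 1 (subset_tsupport _ hs)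
    refine ⟨lt_of_le_of_ne h1.1 ?_, h1.2⟩
    rintro rfl
    exact hs (windowPlateau_eq_zero (by simp))
  rw [← intervalIntegral.integral_eq_integral_of_support_subset hsupp,
    ← intervalIntegral.integral_add_adjacent_intervals (b := 0) (hc.intervalIntegrable _ _)
      (hc.intervalIntegrable _ _)]
  have hshift : ∫ s in (-1 : ℝ)..0, windowPlateau 1 s = ∫ s in (0 : ℝ)..1, windowPlateau 1 (s - 1) := by
    rw [intervalIntegral.integral_comp_sub_right (windowPlateau 1) 1]
    norm_num
  have hc' : Continuous fun s : ℝ ↦ windowPlateau 1 (s - 1) := hc.comp (continuous_sub_right 1)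
  rw [hshift, ← intervalIntegral.integral_add (hc'.intervalIntegrable _ _) (hc.intervalIntegrable _ _)]
  have : ∫ s in (0 : ℝ)..1, (windowPlateau 1 (s - 1) + windowPlateau 1 s) = ∫ _ in (0 : ℝ)..1, (1 : ℝ) := by
    refine intervalIntegral.integral_congr fun s hs ↦ ?_
    rw [uIcc_of_le zero_le_one] at hs
    exact windowPlateau_one_partition hs
  rw [this]
  simp

/-- **Evenness of the Laplace transform:** `Φ₁(−θ) = Φ₁(θ)`. -/
theorem bumpLaplace_windowPlateau_one_neg (θ : ℝ) :
    bumpLaplace (windowPlateau 1) (-θ) = bumpLaplace (windowPlateau 1) θ := by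
  unfold bumpLaplace
  rw [← integral_neg_eq_self (fun s ↦ windowPlateau 1 s * Real.exp (θ * s)) volume]
  congr 1
  ext s
  rw [windowPlateau_even, neg_mul, mul_neg]

/-- **`Φ₁ ≥ 1`:** `1 ≤ bumpLaplace ψ₁ θ` for every `θ` (`Φ₁(θ) = ∫ ψ₁ cosh(θs) ≥ ∫ ψ₁ = 1`). -/
theorem one_le_bumpLaplace_windowPlateau_one (θ : ℝ) : 1 ≤ bumpLaplace (windowPlateau 1) θ := by
  have hint : ∀ θ' : ℝ, Integrable (fun s ↦ windowPlateau 1 s * Real.exp (θ' * s)) := fun θ' ↦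
    ((continuous_windowPlateau 1).mul (by fun_prop)).integrable_of_hasCompactSupport
      ((hasCompactSupport_windowPlateau 1).mul_right)
  have hI : Integrable (windowPlateau 1) :=
    (continuous_windowPlateau 1).integrable_of_hasCompactSupport (hasCompactSupport_windowPlateau 1)
  have hsum : bumpLaplace (windowPlateau 1) θ + bumpLaplace (windowPlateau 1) (-θ)
      = ∫ s, (windowPlateau 1 s * Real.exp (θ * s) + windowPlateau 1 s * Real.exp (-θ * s)) := by
    unfold bumpLaplace
    exact (integral_add (hint θ) (hint (-θ))).symm
  have hmono : ∫ s, windowPlateau 1 s * 2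
      ≤ ∫ s, (windowPlateau 1 s * Real.exp (θ * s) + windowPlateau 1 s * Real.exp (-θ * s)) := by
    refine integral_mono (hI.mul_const 2) ((hint θ).add (hint (-θ))) fun s ↦ ?_
    have hc := Real.one_le_cosh (θ * s)
    rw [Real.cosh_eq] at hc
    have h2 : 2 ≤ Real.exp (θ * s) + Real.exp (-θ * s) := by rw [neg_mul]; linarith
    have := mul_le_mul_of_nonneg_left h2 (windowPlateau_nonneg 1 s)
    simpa only [mul_add] using this
  rw [integral_mul_const, integral_windowPlateau_one, one_mul, ← hsum,
    bumpLaplace_windowPlateau_one_neg] at hmono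
  linarith

/-- The norm quantity `N₁ = ‖ψ₁″‖₁² + ‖ψ₁‴‖₁² + 2‖ψ₁⁗‖₁²` of the fixed bump (the one un-evaluated number). -/
noncomputable def windowBumpNorm : ℝ :=
  (∫ s, |iteratedDeriv 2 (windowPlateau 1) s|) ^ 2 + (∫ s, |iteratedDeriv 3 (windowPlateau 1) s|) ^ 2
    + 2 * (∫ s, |iteratedDeriv 4 (windowPlateau 1) s|) ^ 2

/-- `0 ≤ N₁`. -/
theorem windowBumpNorm_nonneg : 0 ≤ windowBumpNorm := by
  unfold windowBumpNorm; positivity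

/-- `bumpK ψ₁ = 4·zetaDensityConst·N₁ + 1`. -/
theorem bumpK_windowPlateau_one : bumpK (windowPlateau 1) = 4 * zetaDensityConst * windowBumpNorm + 1 := by
  unfold bumpK windowBumpNorm; ring

/-- **Explicit offset.** For `η > 0`:
`doubleLogC0 ψ₁ η ≤ max (log 3 / η) (log (4·bumpK ψ₁ / η⁴ + 1) / (2η))`. -/
theorem doubleLogC0_windowPlateau_one_le {η : ℝ} (hη : 0 < η) :
    doubleLogC0 (windowPlateau 1) η
      ≤ max (Real.log 3 / η) (Real.log (4 * bumpK (windowPlateau 1) / η ^ 4 + 1) / (2 * η)) := by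
  unfold doubleLogC0
  have hΦ := one_le_bumpLaplace_windowPlateau_one η
  have hΦ0 : 0 < bumpLaplace (windowPlateau 1) η := by linarith
  have hK := bumpK_pos (windowPlateau 1)
  rw [bumpLaplace_windowPlateau_one_neg, mul_div_assoc, div_self hΦ0.ne', mul_one,
    show (2 : ℝ) + 1 = 3 by norm_num]
  refine max_le_max le_rfl (div_le_div_of_nonneg_right ?_ (by positivity))
  refine Real.log_le_log (by positivity) ((add_le_add_iff_right 1).mpr ?_)
  rw [← div_div]
  exact div_le_self (by positivity) (one_le_pow₀ hΦ)

/-- **Explicit offset under the named fact.** With `zetaZeroCount_hasanalizade_shen_wong`: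
`doubleLogC0 ψ₁ η ≤ max (log 3 / η) (log (4(108000·N₁ + 1)/η⁴ + 1) / (2η))` (`η > 0`). -/
theorem doubleLogC0_windowPlateau_one_le_of_hsw (h : zetaZeroCount_hasanalizade_shen_wong) {η : ℝ}
    (hη : 0 < η) :
    doubleLogC0 (windowPlateau 1) η
      ≤ max (Real.log 3 / η) (Real.log (4 * (108000 * windowBumpNorm + 1) / η ^ 4 + 1) / (2 * η)) := by
  refine (doubleLogC0_windowPlateau_one_le hη).trans (max_le_max le_rfl ?_)
  have hK := bumpK_pos (windowPlateau 1)
  have hKle : bumpK (windowPlateau 1) ≤ 108000 * windowBumpNorm + 1 := by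
    have := bumpK_le_of_hsw h (windowPlateau 1)
    unfold windowBumpNorm
    linarith
  refine div_le_div_of_nonneg_right
    (Real.log_le_log (by positivity) ((add_le_add_iff_right 1).mpr ?_)) (by positivity)
  exact div_le_div_of_nonneg_right (by linarith) (by positivity)

/-- **Fully explicit exclusion (T20 with numbers).** Assume the explicit zero count of
Hasanalizade–Shen–Wong. Let `0 < |η| < ½`, `|γ₀| ≥ 1`,
`c ≥ max (log 3/|η|) (log (4(108000·N₁+1)/η⁴ + 1)/(2|η|)) + log log(|γ₀|+2)/(2|η|)`, `R ≥ 1`,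
`e^{c+1} ≤ R²`; if RH holds in the window `|Im ρ − γ₀| < R` except possibly at the pair
`½ ± |η| + iγ₀`, and the Weil form is nonnegative on tests supported in `[−(c+1), c+1]`, then
`ζ(½ + η + iγ₀) ≠ 0`. Here `N₁ = windowBumpNorm` is an absolute constant (the only un-evaluated one). -/
theorem riemannZeta_ne_zero_of_local_explicit (h : zetaZeroCount_hasanalizade_shen_wong) {η : ℝ}
    (hη0 : η ≠ 0) (hη : |η| < 1 / 2) :
    ∀ (γ₀ c R : ℝ), 1 ≤ |γ₀| →
      max (Real.log 3 / |η|) (Real.log (4 * (108000 * windowBumpNorm + 1) / |η| ^ 4 + 1) / (2 * |η|))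
        + Real.log (Real.log (|γ₀| + 2)) / (2 * |η|) ≤ c →
      1 ≤ R → Real.exp (c + 1) ≤ R ^ 2 →
      (∀ ρ : ℂ, riemannZeta ρ = 0 → 0 ≤ ρ.re → ρ.re ≤ 1 → |ρ.im - γ₀| < R → ρ.re ≠ 1 / 2 →
          ρ = 1 / 2 + ↑|η| + γ₀ * I ∨ ρ = 1 / 2 - ↑|η| + γ₀ * I) →
      0 ≤ weilGroundEnergy (c + 1) →
      riemannZeta (1 / 2 + η + γ₀ * I) ≠ 0 := by
  intro γ₀ c R hγ hc hR hRc hloc hpos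
  have hb := doubleLogC0_windowPlateau_one_le_of_hsw h (abs_pos.mpr hη0)
  exact riemannZeta_ne_zero_of_local_of_weilGroundEnergy_nonneg_eff hη0 hη γ₀ c R hγ
    (by linarith) hR hRc hloc hpos

end Summit.RiemannHypothesis.RiemannHypothesis.Theorems
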